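import Summits.NavierStokesRegularity.NavierStokesRegularity.Theorems.ExtremiserTransienceNearExtremalTransienceExtremiserLiouvilleConstantSpeedSlabEnergySandwich
import Mathlib.Analysis.SpecialFunctions.ImproperIntegrals
import HarnessLib

/-!
# Crux `ExtremiserTransience.NearExtremalTransience` (stmt-NavierStokesRegularity-21883), line `extremiser_liouville`,
# stub K1b — the WEIGHTED AXIAL ENERGY of a jet: `∫ ‖V‖²/(1 + (x₂ − t)²) ≤ 3π·E₀` uniformly in the height `t`

`--supports stmt-NavierStokesRegularity-21883` (helper).  Author: prover seat `ns-el-k1b` (g7).  This is the per-height input of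
the anisotropic Newton bound (`…NewtonAnisotropic`) for the AXIAL corrector of the slab rate: for the residue JET the window
energies `E(s) = ∫H′(x₂ − s)‖V‖² ≡ E₀` (`H = Real.smoothTransition`; energy-flux invariance, g5) give, with `w(u) = (1+u²)⁻¹`:

* `inv_one_add_sq_le_integral` — `w(u) ≤ 3·∫ H′(u − s)·w(s) ds` (`H′ ≥ 0`, `∫H′ = 1`, `supp H′ ⊆ [0,1]`, and `w(s) ≥ w(u)/3`
  for `s ∈ [u−1, u]`);
* `lintegral_sq_mul_inv_one_add_sq_le` — **`∫⁻ ‖V x‖²·w(x₂ − t) dx ≤ 3π·E₀` for every `t`** (Tonelli: `∫_x∫_s H′(x₂−t−s)w(s)‖V‖² =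
  ∫_s w(s)·E(t+s) ds = E₀·∫w = πE₀`);
* `integral_mul_inv_one_add_sq_le` — for any `f` with `|f| ≤ A‖V‖²`:
  `∫ |f(x)|·w(x₂ − t) dx ≤ 3π·A·E₀`.

WHAT THIS IS NOT: K1b is NOT proved; nothing here proves NS regularity. [folklore]
-/

noncomputable section

open Set Filter Topology MeasureTheory Metric Function Real
open scoped ENNReal NNReal Topology InnerProductSpace RealInnerProductSpace ContDiff

namespace Summit.NavierStokesRegularity.NavierStokesRegularity.Theorems

-- the problem directory repeats the summit name (`NavierStokesRegularity/NavierStokesRegularity`)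
set_option linter.dupNamespace false

namespace ExtremiserLiouville

open Literature.Analysis.FluidPDE

variable {V : EuclideanSpace ℝ (Fin 3) → EuclideanSpace ℝ (Fin 3)}

/-! ## 1. One-dimensional facts about `H′` and the weight `w(u) = (1 + u²)⁻¹` -/

/-- `∫ H′ = 1`. [folklore] -/
theorem integral_deriv_smoothTransition : ∫ u, deriv Real.smoothTransition u = 1 := by
  have hsupp : support (deriv Real.smoothTransition) ⊆ Ioc (0 : ℝ) 1 := by
    intro u hu
    rw [mem_support] at hu
    have h := pos_and_lt_one_of_deriv_smoothTransition_ne_zero hu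
    exact ⟨h.1, h.2.le⟩
  rw [← intervalIntegral.integral_eq_integral_of_support_subset hsupp]
  rw [intervalIntegral.integral_deriv_eq_sub
    (fun x _ => (Real.smoothTransition.contDiff (n := 1)).differentiable one_ne_zero x)
    (((Real.smoothTransition.contDiff (n := 1)).continuous_deriv le_rfl).intervalIntegrable _ _)]
  rw [Real.smoothTransition.one, Real.smoothTransition.zero, sub_zero]

/-- `∫ H′(u − s) ds = 1`. [folklore] -/
theorem integral_deriv_smoothTransition_sub (u : ℝ) : ∫ s, deriv Real.smoothTransition (u - s) = 1 := by
  rw [integral_sub_left_eq_self (deriv Real.smoothTransition) volume u]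
  exact integral_deriv_smoothTransition

/-- `s ↦ H′(u − s)` has compact support (inside `[u−1, u]`). [folklore] -/
theorem hasCompactSupport_deriv_smoothTransition_sub (u : ℝ) :
    HasCompactSupport (fun s : ℝ => deriv Real.smoothTransition (u - s)) := by
  refine HasCompactSupport.of_support_subset_isCompact (isCompact_Icc (a := u - 1) (b := u)) fun s hs => ?_
  rw [mem_support] at hs
  have h := pos_and_lt_one_of_deriv_smoothTransition_ne_zero hs
  exact ⟨by linarith [h.2], by linarith [h.1]⟩

/-- **`(1 + u²)⁻¹ ≤ 3·∫ H′(u − s)(1 + s²)⁻¹ ds`.** [folklore] -/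
theorem inv_one_add_sq_le_integral (u : ℝ) :
    (1 + u ^ 2)⁻¹ ≤ 3 * ∫ s, deriv Real.smoothTransition (u - s) * (1 + s ^ 2)⁻¹ := by
  -- pointwise: `H′(u−s)·(w(u)/3) ≤ H′(u−s)·w(s)`
  have hpt : ∀ s, deriv Real.smoothTransition (u - s) * ((1 + u ^ 2)⁻¹ / 3) ≤
      deriv Real.smoothTransition (u - s) * (1 + s ^ 2)⁻¹ := by
    intro s
    by_cases hs : deriv Real.smoothTransition (u - s) = 0
    · rw [hs, zero_mul, zero_mul]
    · have h := pos_and_lt_one_of_deriv_smoothTransition_ne_zero hs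
      refine mul_le_mul_of_nonneg_left ?_ Real.smoothTransition.monotone.deriv_nonneg
      have h1 : s ^ 2 ≤ 2 * u ^ 2 + 2 * (u - s) ^ 2 := by nlinarith [sq_nonneg (2 * u - s)]
      have h2 : (u - s) ^ 2 < 1 := by nlinarith [h.1, h.2]
      have hs2 : 1 + s ^ 2 ≤ 3 * (1 + u ^ 2) := by nlinarith [h1, h2, sq_nonneg u]
      rw [show (1 + u ^ 2)⁻¹ / 3 = (3 * (1 + u ^ 2))⁻¹ by rw [mul_inv, div_eq_mul_inv, mul_comm]]
      exact inv_anti₀ (by positivity) hs2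
  have hc : Continuous fun s : ℝ => deriv Real.smoothTransition (u - s) :=
    ((Real.smoothTransition.contDiff (n := 1)).continuous_deriv le_rfl).comp (continuous_const.sub continuous_id)
  have hK := hasCompactSupport_deriv_smoothTransition_sub u
  have i1 : Integrable (fun s : ℝ => deriv Real.smoothTransition (u - s) * ((1 + u ^ 2)⁻¹ / 3)) volume :=
    (hc.mul continuous_const).integrable_of_hasCompactSupport hK.mul_right
  have hw : Continuous fun s : ℝ => (1 + s ^ 2)⁻¹ := by
    refine Continuous.inv₀ (by fun_prop) fun s => by positivity
  have i2 : Integrable (fun s : ℝ => deriv Real.smoothTransition (u - s) * (1 + s ^ 2)⁻¹) volume :=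
    (hc.mul hw).integrable_of_hasCompactSupport hK.mul_right
  have h := integral_mono i1 i2 hpt
  rw [integral_mul_const, integral_deriv_smoothTransition_sub, one_mul] at h
  linarith

/-! ## 2. The weighted axial energy of a jet -/

/-- **`∫⁻ ‖V x‖²·(1 + (x₂ − t)²)⁻¹ dx ≤ 3π·E₀`** for every height `t`, whenever all slabs `{|x₂| ≤ T}` have finite energy and
the window energies are constant: `∫ H′(x₂ − s)‖V x‖² dx = E₀` for all `s`. [folklore] -/
theorem lintegral_sq_mul_inv_one_add_sq_le (hV : Continuous V)
    (hslab : ∀ T : ℝ, 0 < T →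
      Integrable (fun x => {x : EuclideanSpace ℝ (Fin 3) | |x 2| ≤ T}.indicator (fun x => ‖V x‖ ^ 2) x) volume)
    {E₀ : ℝ} (hE : ∀ s : ℝ, (∫ x, deriv Real.smoothTransition (x 2 - s) * ‖V x‖ ^ 2) = E₀) (t : ℝ) :
    ∫⁻ x, ENNReal.ofReal (‖V x‖ ^ 2 * (1 + (x 2 - t) ^ 2)⁻¹) ≤ ENNReal.ofReal (3 * π * E₀) := by
  have hE0 : 0 ≤ E₀ := by
    rw [← hE 0]
    exact integral_nonneg fun x => mul_nonneg Real.smoothTransition.monotone.deriv_nonneg (sq_nonneg _)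
  -- the two-variable integrand
  set F : EuclideanSpace ℝ (Fin 3) → ℝ → ℝ≥0∞ := fun x s =>
    ENNReal.ofReal (3 * (deriv Real.smoothTransition (x 2 - t - s) * (1 + s ^ 2)⁻¹) * ‖V x‖ ^ 2) with hF
  have hc2 : Continuous fun x : EuclideanSpace ℝ (Fin 3) => x 2 := (EuclideanSpace.proj (2 : Fin 3)).continuous
  have hFm : AEMeasurable (uncurry F) ((volume : Measure (EuclideanSpace ℝ (Fin 3))).prod (volume : Measure ℝ)) := by
    refine (ENNReal.measurable_ofReal.comp (Continuous.measurable ?_)).aemeasurable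
    refine ((continuous_const.mul ((((Real.smoothTransition.contDiff (n := 1)).continuous_deriv le_rfl).comp ?_).mul ?_)).mul ?_)
    · exact ((hc2.comp continuous_fst).sub continuous_const).sub continuous_snd
    · exact Continuous.inv₀ (by fun_prop) fun p => by positivity
    · exact (hV.comp continuous_fst).norm.pow 2
  -- step 1: pointwise in `x`, `‖V‖² w(x₂ − t) ≤ ∫⁻_s F x s`
  have hstep1 : ∀ x, ENNReal.ofReal (‖V x‖ ^ 2 * (1 + (x 2 - t) ^ 2)⁻¹) ≤ ∫⁻ s, F x s := by
    intro x
    have hw := inv_one_add_sq_le_integral (x 2 - t)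
    have hc : Continuous fun s : ℝ => deriv Real.smoothTransition (x 2 - t - s) :=
      ((Real.smoothTransition.contDiff (n := 1)).continuous_deriv le_rfl).comp (continuous_const.sub continuous_id)
    have hws : Continuous fun s : ℝ => (1 + s ^ 2)⁻¹ := Continuous.inv₀ (by fun_prop) fun s => by positivity
    have hnn : ∀ s, 0 ≤ 3 * (deriv Real.smoothTransition (x 2 - t - s) * (1 + s ^ 2)⁻¹) * ‖V x‖ ^ 2 := fun s => by
      have := (Real.smoothTransition.monotone.deriv_nonneg (x := x 2 - t - s)); positivity
    have hi : Integrable (fun s : ℝ => 3 * (deriv Real.smoothTransition (x 2 - t - s) * (1 + s ^ 2)⁻¹) * ‖V x‖ ^ 2) volume :=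
      ((continuous_const.mul (hc.mul hws)).mul continuous_const).integrable_of_hasCompactSupport
        (((hasCompactSupport_deriv_smoothTransition_sub (x 2 - t)).mul_right).mul_left.mul_right)
    calc ENNReal.ofReal (‖V x‖ ^ 2 * (1 + (x 2 - t) ^ 2)⁻¹)
        ≤ ENNReal.ofReal (∫ s, 3 * (deriv Real.smoothTransition (x 2 - t - s) * (1 + s ^ 2)⁻¹) * ‖V x‖ ^ 2) := by
          refine ENNReal.ofReal_le_ofReal ?_
          rw [integral_mul_const, integral_const_mul]
          nlinarith [hw, sq_nonneg ‖V x‖]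
      _ = ∫⁻ s, F x s := by
          rw [ofReal_integral_eq_lintegral_ofReal hi (Eventually.of_forall hnn)]
  -- step 2: swap and evaluate the inner `x`-integral with the window energy
  have hstep2 : ∀ s, ∫⁻ x, F x s = ENNReal.ofReal (3 * (1 + s ^ 2)⁻¹ * E₀) := by
    intro s
    have hws0 : 0 ≤ (1 + s ^ 2)⁻¹ := by positivity
    have e : ∀ x, F x s = ENNReal.ofReal (3 * (1 + s ^ 2)⁻¹) *
        ENNReal.ofReal (deriv Real.smoothTransition (x 2 - (t + s)) * ‖V x‖ ^ 2) := by
      intro x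
      rw [hF]; dsimp only
      rw [← ENNReal.ofReal_mul (by positivity), show x 2 - t - s = x 2 - (t + s) by ring]
      congr 1; ring
    simp_rw [e]
    rw [lintegral_const_mul' _ _ ENNReal.ofReal_ne_top]
    have hi : Integrable (fun x : EuclideanSpace ℝ (Fin 3) => deriv Real.smoothTransition (x 2 - (t + s)) * ‖V x‖ ^ 2) volume :=
      integrable_deriv_smoothTransition_mul_sq hV (le_refl (|t + s| + 1)) (hslab _ (by positivity))
    rw [← ofReal_integral_eq_lintegral_ofReal hi
      (Eventually.of_forall fun x => mul_nonneg Real.smoothTransition.monotone.deriv_nonneg (sq_nonneg _)), hE (t + s),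
      ← ENNReal.ofReal_mul (by positivity)]
  -- assemble
  calc ∫⁻ x, ENNReal.ofReal (‖V x‖ ^ 2 * (1 + (x 2 - t) ^ 2)⁻¹)
      ≤ ∫⁻ x, ∫⁻ s, F x s := lintegral_mono hstep1
    _ = ∫⁻ s, ∫⁻ x, F x s := lintegral_lintegral_swap hFm
    _ = ∫⁻ s, ENNReal.ofReal (3 * (1 + s ^ 2)⁻¹ * E₀) := lintegral_congr hstep2
    _ = ENNReal.ofReal (3 * π * E₀) := by
        have hi : Integrable (fun s : ℝ => 3 * (1 + s ^ 2)⁻¹ * E₀) volume :=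
          (integrable_inv_one_add_sq.const_mul 3).mul_const E₀
        rw [← ofReal_integral_eq_lintegral_ofReal hi (Eventually.of_forall fun s => by positivity),
          integral_mul_const, integral_const_mul, integral_univ_inv_one_add_sq]

/-- **Real-valued form with a quadratic majorant**: for any `f` with `|f| ≤ A‖V‖²`,
`∫ |f(x)|·(1 + (x₂ − t)²)⁻¹ dx ≤ 3π·A·E₀`. [folklore] -/
theorem integral_mul_inv_one_add_sq_le (hV : Continuous V)
    (hslab : ∀ T : ℝ, 0 < T →
      Integrable (fun x => {x : EuclideanSpace ℝ (Fin 3) | |x 2| ≤ T}.indicator (fun x => ‖V x‖ ^ 2) x) volume)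
    {E₀ : ℝ} (hE : ∀ s : ℝ, (∫ x, deriv Real.smoothTransition (x 2 - s) * ‖V x‖ ^ 2) = E₀)
    {f : EuclideanSpace ℝ (Fin 3) → ℝ} {A : ℝ} (hA0 : 0 ≤ A) (hA : ∀ x, |f x| ≤ A * ‖V x‖ ^ 2) (t : ℝ) :
    ∫ x, |f x| * (1 + (x 2 - t) ^ 2)⁻¹ ≤ 3 * π * A * E₀ := by
  have hE0 : 0 ≤ E₀ := by
    rw [← hE 0]
    exact integral_nonneg fun x => mul_nonneg Real.smoothTransition.monotone.deriv_nonneg (sq_nonneg _)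
  have hc2 : Continuous fun x : EuclideanSpace ℝ (Fin 3) => x 2 := (EuclideanSpace.proj (2 : Fin 3)).continuous
  have hw : Continuous fun x : EuclideanSpace ℝ (Fin 3) => (1 + (x 2 - t) ^ 2)⁻¹ :=
    Continuous.inv₀ (by fun_prop) fun x => by positivity
  -- the majorant `A‖V‖²w` is integrable (finite lintegral)
  have hmeas : AEStronglyMeasurable (fun x => A * (‖V x‖ ^ 2 * (1 + (x 2 - t) ^ 2)⁻¹)) volume :=
    (continuous_const.mul ((hV.norm.pow 2).mul hw)).aestronglyMeasurable
  have hlt := lintegral_sq_mul_inv_one_add_sq_le hV hslab hE t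
  have hint : Integrable (fun x => ‖V x‖ ^ 2 * (1 + (x 2 - t) ^ 2)⁻¹) volume := by
    refine ⟨((hV.norm.pow 2).mul hw).aestronglyMeasurable, ?_⟩
    rw [hasFiniteIntegral_iff_ofReal (Eventually.of_forall fun x => by positivity)]
    exact hlt.trans_lt ENNReal.ofReal_lt_top
  have hle : (∫ x, ‖V x‖ ^ 2 * (1 + (x 2 - t) ^ 2)⁻¹) ≤ 3 * π * E₀ := by
    rw [integral_eq_lintegral_of_nonneg_ae (Eventually.of_forall fun x => by positivity) hint.1]
    exact ENNReal.toReal_le_of_le_ofReal (by positivity) hlt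
  calc ∫ x, |f x| * (1 + (x 2 - t) ^ 2)⁻¹ ≤ ∫ x, A * (‖V x‖ ^ 2 * (1 + (x 2 - t) ^ 2)⁻¹) := by
        refine integral_mono_of_nonneg (Eventually.of_forall fun x => by positivity) (hint.const_mul A)
          (Eventually.of_forall fun x => ?_)
        have := hA x
        have hw0 : 0 ≤ (1 + (x 2 - t) ^ 2)⁻¹ := by positivity
        nlinarith [this, hw0]
    _ = A * ∫ x, ‖V x‖ ^ 2 * (1 + (x 2 - t) ^ 2)⁻¹ := integral_const_mul _ _
    _ ≤ A * (3 * π * E₀) := mul_le_mul_of_nonneg_left hle hA0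
    _ = 3 * π * A * E₀ := by ring

end ExtremiserLiouville

end Summit.NavierStokesRegularity.NavierStokesRegularity.Theorems

end
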